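import Summits.MatrixMultiplication.OmegaCensus.SmallFormats.MatMul22nRankGF7PatternList
import HarnessLib

/-!
# ω-census family (a): normalised slack-4 pattern search, subtrees part 2 of 5 (kernel replay)

Cell `pub-omega` (unit `pub-omega-tensor-g15`), topic `Summits/MatrixMultiplication/OmegaCensus` (sub-folder `SmallFormats`).
Framing (verbatim): lottery ticket; floor = certified bounds/negative ranges. HONEST FRAMING: machine-generated data / kernel replays
(`pub-omega-tensor-g15/code/gen_patternparts.py`) for step P1 of `pub-omega-tensor-g15/KERNEL-S4-DESIGN.md`; nothing here is progress on `ω`.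
Each theorem: the memory-bounded search `dfs7m 4 normMem7` succeeds from the listed depth-9 states
(30934 search nodes in this file).
-/

namespace Summit.MatrixMultiplication.OmegaCensus.SmallFormats

/-- Depth-9 states, part 2.1 (5898 nodes). -/
def G7_2_1 : List ℕ := [1622598958015941947275041951613124, 1622598958015941947275041951547652, 1622598958015941947275041951580420]

set_option maxRecDepth 100000 in
set_option maxHeartbeats 40000000 in
/-- The search succeeds from the states `G7_2_1`. -/
theorem G7_2_1_ok : (G7_2_1.all fun A => dfs7m 4 normMem7 42 9 A) = true := by decide +kernel

/-- Depth-9 states, part 2.2 (5857 nodes). -/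
def G7_2_2 : List ℕ := [1622598958015941947275041951613188, 1622598958015941947275041951547716, 1622598958015941947275041951580484, 1622598958015941947275041951613252, 1622598958015941947274973232332996, 1622598958015941947274973232365764, 1622598958015941947274973232398532, 1622598958015941947274973232333060]

set_option maxRecDepth 100000 in
set_option maxHeartbeats 40000000 in
/-- The search succeeds from the states `G7_2_2`. -/
theorem G7_2_2_ok : (G7_2_2.all fun A => dfs7m 4 normMem7 42 9 A) = true := by decide +kernel

/-- Depth-9 states, part 2.3 (5751 nodes). -/
def G7_2_3 : List ℕ := [1622598958015941947274973232365828, 1622598958015941947274973232398596, 1622598958015941947274973232333124]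

set_option maxRecDepth 100000 in
set_option maxHeartbeats 40000000 in
/-- The search succeeds from the states `G7_2_3`. -/
theorem G7_2_3_ok : (G7_2_3.all fun A => dfs7m 4 normMem7 42 9 A) = true := by decide +kernel

/-- Depth-9 states, part 2.4 (4252 nodes). -/
def G7_2_4 : List ℕ := [1622598958015941947274973232365892, 1622598958015941947274973232398660, 1622598958011219580792172306596036]

set_option maxRecDepth 100000 in
set_option maxHeartbeats 40000000 in
/-- The search succeeds from the states `G7_2_4`. -/
theorem G7_2_4_ok : (G7_2_4.all fun A => dfs7m 4 normMem7 42 9 A) = true := by decide +kernel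

/-- Depth-9 states, part 2.5 (3631 nodes). -/
def G7_2_5 : List ℕ := [1622598958011219580792172306628804, 1622598958011219580792172306661572]

set_option maxRecDepth 100000 in
set_option maxHeartbeats 40000000 in
/-- The search succeeds from the states `G7_2_5`. -/
theorem G7_2_5_ok : (G7_2_5.all fun A => dfs7m 4 normMem7 42 9 A) = true := by decide +kernel

/-- Depth-9 states, part 2.6 (5545 nodes). -/
def G7_2_6 : List ℕ := [1622598958011219580792172306596100, 1622598958011219580792172306628868, 1622598958011219580792172306661636]

set_option maxRecDepth 100000 in
set_option maxHeartbeats 40000000 in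
/-- The search succeeds from the states `G7_2_6`. -/
theorem G7_2_6_ok : (G7_2_6.all fun A => dfs7m 4 normMem7 42 9 A) = true := by decide +kernel

/-- All states of part 2. -/
def G7_2 : List ℕ := G7_2_1 ++ G7_2_2 ++ G7_2_3 ++ G7_2_4 ++ G7_2_5 ++ G7_2_6

/-- The search succeeds from every state of part 2. -/
theorem G7_2_ok : (G7_2.all fun A => dfs7m 4 normMem7 42 9 A) = true := by
  simp only [G7_2, List.all_append, G7_2_1_ok, G7_2_2_ok, G7_2_3_ok, G7_2_4_ok, G7_2_5_ok, G7_2_6_ok, Bool.and_self]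

end Summit.MatrixMultiplication.OmegaCensus.SmallFormats
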